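import Summits.BirchSwinnertonDyer.BirchSwinnertonDyer.Theorems.SignedBaseChangeAnticyclotomicEisensteinDivisibilityAwayDiscrepancyLocal
import Summits.BirchSwinnertonDyer.BirchSwinnertonDyer.Theorems.CumulativeHeegnerLeopoldtCumulativeHeegnerInclusionAtThreeStubResidualSelmerFinitePrintHypotheses
import Summits.BirchSwinnertonDyer.BirchSwinnertonDyer.Theorems.EisensteinPrimesUnramifiedLeAwayKer
import Literature.NumberTheory.EllipticCurves.TwoVariableAnticyclotomicControlLocalProofs
import Literature.NumberTheory.EllipticCurves.BigRepModuleShapiroSelmerConditionsProofs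
import Literature.NumberTheory.EllipticCurves.ZpExtensionUnramifiedProofs
import Literature.NumberTheory.EllipticCurves.AnticyclotomicPrimeDecompositionSplitProofs
import Literature.NumberTheory.EllipticCurves.StrictSelmerRankOneDegreeOneProofs
import Literature.NumberTheory.EllipticCurves.SupersingularInertiaNoFixedPointProofs
import Literature.NumberTheory.EllipticCurves.SerreInertiaImageBaseChangeProofs
import Literature.NumberTheory.GaloisRepresentations.DecompositionGroupOfCompletion
import Mathlib.RingTheory.Ideal.Int
import HarnessLib

/-!
# On the Heegner leaf the one-variable away-from-`p` discrepancy VANISHES: Greenberg–Vatsal's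
# `datumStrictSelmer (ker κ) E_K[p^∞] p (bdpData 𝔭) ∅` EQUALS Castella's `Sel_𝔭(K_∞⁻, E_K[p^∞])`, and at a
# supersingular `p` the two-variable Greenberg condition over `K̃_∞` descends EXACTLY to Castella's over `K_∞⁻`
# (crux `AnticyclotomicEisensteinDivisibility`, stmt-BirchSwinnertonDyer-20727, line `bdpline`; helper)

Lead seat bsd-line-sbc-p1 gen 3 (2026-08-28); sequel of `…AwayDiscrepancy.lean` (stub (b₁) with a bounded
integer `t`). The integer `t` is only needed at BAD places `v ∤ p` that split completely in the
anticyclotomic tower. On the Heegner leaf there are none: a bad place of `E_K = W ×_ℚ K` lies over a prime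
`ℓ ∣ N` (`ncard_primesOver_under_eq_two_of_bad_of_heegner`), which splits in `K`, so the place has degree
one (`ramificationIdx_eq_one_and_inertiaDeg_eq_one_of_ncard_primesOver_eq_two`) and is therefore NOT
completely split in `K_∞^ac` — Brink 2007 Thm. 2, PROVED in the tree
(`ZpExtension.decomp_not_le_kerSubgroup_of_isAnticyclotomic_holds`). Hence:

* §1 `not_decomp_le_kerSubgroup_of_bad_of_heegner` — bad `v ∤ p` ⟹ `D_v ⊄ Gal(K̄/K_∞^ac)`.
* §2 `datumStrictSelmer_le_selmerAc_of_heegner` / `mem_selmerAc_iff_mem_datumStrictSelmer_of_heegner` — for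
  `W/ℚ`, `K` imaginary quadratic with the Heegner hypothesis for `N = N_W`, odd `p`, `κ` anticyclotomic and
  `𝔭 ∋ p`: `datumStrictSelmer (ker κ) E_K[p^∞] p (bdpData 𝔭) ∅ = Sel_𝔭(K_∞⁻, E_K[p^∞])` (Castella 2018 §2.2:
  "`ℋ^ur_v` vanishes"; the `t = 1` case of `exists_nsmul_mem_selmerAc_of_mem_datumStrictSelmer`).
* §3 `resOfLe_mem_unrSelmer₂_iff_mem_selmerAc_of_heegner` — at a good SUPERSINGULAR `p = v v̄` split in `K`
  (`p ∣ a_p`, `p ≠ 2`), with `κ₁` cyclotomic: a class over `K_∞⁻` restricts into the two-variable Greenberg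
  group `H¹_{nr,v̄}(K̃_∞, E[p^∞])` IFF it lies in `Sel_v̄(K_∞⁻, E[p^∞])` — EXACT descent of local conditions
  (the width seat's `resOfLe_mem_unrSelmer₂_iff_mem_datumStrictSelmer`, its hypothesis (V) discharged by the
  PROVED Serre Prop. 12 (c) shape `isCyclic_and_card_inertia_map_baseChange` +
  `primary_eq_zero_of_forall_pairKer_inf_inertia_smul_eq`, then §2). This is the text of the sibling crux's
  registered stub `stub_localConditionsDescendSS` (stmt-BirchSwinnertonDyer-20728, line `ratlift`) with its
  idle binders removed; it is landed here as a helper of 20727 only.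

Theorems only (no definition, no named fact, no `sorry`); ROUTE-INDEPENDENT (no `Theses` import, unlike the
stub file `…AwayDiscrepancy.lean`). BSD / the cruxes are not proved by this file.

References: F. Castella, Camb. J. Math. 6 (2018), §2.2 (arXiv:1704.06608 p. 7); D. Brink, *Prime
decomposition in the anti-cyclotomic extension*, Math. Comp. 76 (2007), Thm. 2 and Cor. 1; B. Gross,
*Kolyvagin's work on modular elliptic curves* (1991), §1; R. Greenberg, LNM 1716 (1999), §3 Lemma 3.3;
J.-P. Serre, Invent. Math. 15 (1972), §1.11 Prop. 12; C. Skinner, E. Urban, Invent. Math. 195 (2014), §3.2.7.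
-/

-- D-0017: single-problem summit, the namespace repeats the problem name by design.
set_option linter.dupNamespace false
set_option autoImplicit false

noncomputable section

open scoped Classical

open NumberField IsDedekindDomain Field
open Literature.NumberTheory.EllipticCurves Literature.NumberTheory.EllipticCurves.GreenbergSelmer
  Literature.NumberTheory.EllipticCurves.GreenbergVatsal2000 Literature.NumberTheory.GaloisRepresentations
  IsDedekindDomain.HeightOneSpectrum

namespace Summit.BirchSwinnertonDyer.BirchSwinnertonDyer.Theorems.SignedBaseChangeAcDivAwayDiscrepancy

open Literature.NumberTheory.EllipticCurves.Castella2018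
  Summit.BirchSwinnertonDyer.BirchSwinnertonDyer.Theorems.CumulativeHeegnerInclusionAtThreeStubB1PrintHypotheses

variable (W : WeierstrassCurve ℚ) [W.IsElliptic] (K : Type) [Field K] [NumberField K]
  (p : ℕ) [Fact p.Prime]

/-! ## §0 Two small local lemmas (route-independent copies) -/

section Small

variable {L : Type} [Field L] [NumberField L] {M : Type} [AddCommGroup M]
  [DistribMulAction (absoluteGaloisGroup L) M] [TopologicalSpace M] [DiscreteTopology M]
  {H : Subgroup (absoluteGaloisGroup L)}

omit [NumberField L] in
/-- **Complex places impose nothing**: at an infinite place `w` with `D_w = ⊥` (e.g. a complex place,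
`BigGaloisRep.decompInf_eq_bot_of_isComplex`) every class of `H¹(H, M)` lies in `infKer H M w` (`H¹` of the
trivial group vanishes). [cite: GreenbergLNM1716, §3 p. 87 (archimedean primes)] -/
theorem mem_infKer_of_decompInf_eq_bot_of_discrete (w : InfinitePlace L) (hw : decompInf w = ⊥)
    (c : subgroupH1 H M) : c ∈ infKer H M w := by
  rw [infKer, AddMonoidHom.mem_ker]
  obtain ⟨ψ, hψ⟩ := oneCocycleClass_surjective _ (resOfLe M (inf_le_left : H ⊓ decompInf w ≤ H) c)
  rw [← hψ]
  have h0 : ψ = 0 := by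
    apply Subtype.ext
    refine ContinuousMap.ext fun x ↦ ?_
    have hx : x = 1 := by
      apply Subtype.ext
      have h : (x : absoluteGaloisGroup L) ∈ (⊥ : Subgroup (absoluteGaloisGroup L)) := by
        rw [← hw]; exact (Subgroup.mem_inf.mp x.2).2
      exact Subgroup.mem_bot.mp h
    rw [hx]
    exact contOneCocycles.apply_one ψ
  rw [h0, oneCocycleClass_zero]

/-- **Locally trivial ⟹ unramified** (`awayKer ≤ unramifiedKer`): the restriction to `H ⊓ I_v` factors
through `H ⊓ D_v`. (The cell bsd-eis's `awayKer_le_unramifiedKer`, re-proved to keep this file's import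
cone small.) [cite: Greenberg1989, §1 p. 98] [cite: GreenbergVatsal2000, §2 p. 17] -/
theorem awayKer_le_unramifiedKer' (v : HeightOneSpectrum (𝓞 L)) : awayKer H M v ≤ unramifiedKer H M v := by
  intro c hc
  obtain ⟨z, rfl⟩ := oneCocycleClass_surjective _ c
  rw [awayKer, AddMonoidHom.mem_ker] at hc
  obtain ⟨a, ha⟩ := (CocycleCriteria.resOfLe_oneCocycleClass_eq_zero_iff inf_le_left z).mp hc
  rw [GreenbergVatsal2000.unramifiedKer, AddMonoidHom.mem_ker,
    CocycleCriteria.resH1Hom_oneCocycleClass_eq_zero_iff]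
  refine ⟨a, fun y ↦ ?_⟩
  exact ha ⟨((y : decomp v) : absoluteGaloisGroup L),
    Subgroup.mem_inf.2 ⟨((mem_inertiaIn_iff H v y).1 y.2).1, (y : decomp v).2⟩⟩

end Small

/-! ## §1 Bad places do not split completely in the anticyclotomic tower (Heegner leaf) -/

/-- **On the Heegner leaf a bad place `v ∤ p` of `E_K` is NOT completely split in `K_∞^ac`**
(`D_v ⊄ Gal(K̄/K_∞^ac)`): `v` lies over some `ℓ ∣ N`, which splits in `K` by the Heegner hypothesis, so
`e(v|ℓ) = f(v|ℓ) = 1`, and a degree-one place away from `p` of an imaginary quadratic field is finitely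
decomposed in the anticyclotomic `ℤ_p`-extension (Brink 2007 Thm. 2, tree theorem
`ZpExtension.decomp_not_le_kerSubgroup_of_isAnticyclotomic_holds`). [cite: Brink2007, Thm. 2 and Cor. 1 (p. 2136)]
[cite: GrossLMS1991, §1 (p. 235)] -/
theorem not_decomp_le_kerSubgroup_of_bad_of_heegner (hK : IsImaginaryQuadratic K) (hp2 : p ≠ 2)
    {N : ℕ} (hN : W.conductorNorm ℤ = N) (hH : SatisfiesHeegnerHypothesis N K)
    (κ : ZpExtension K p) (hκ : κ.IsAnticyclotomic) {v : HeightOneSpectrum (𝓞 K)}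
    (hpv : ((p : ℕ) : 𝓞 K) ∉ v.asIdeal) (hbad : ¬ (W.baseChange K).HasGoodReductionAt v) :
    ¬ decomp v ≤ κ.kerSubgroup := by
  have h2 := ncard_primesOver_under_eq_two_of_bad_of_heegner W K hN hH hbad
  -- the rational prime `ℓ` below `v`
  obtain ⟨ℓ, hℓ, hℓv⟩ : ∃ ℓ : ℕ, ℓ.Prime ∧ (ℓ : 𝓞 K) ∈ v.asIdeal := by
    haveI : v.asIdeal.IsPrime := v.isPrime
    haveI : NeZero v.asIdeal := ⟨by rw [Ideal.zero_eq_bot]; exact v.ne_bot⟩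
    exact ⟨_, Nat.absNorm_under_prime v.asIdeal, Int.absNorm_under_mem v.asIdeal⟩
  haveI : Fact ℓ.Prime := ⟨hℓ⟩
  rw [under_int_eq_span_of_natCast_mem hℓ v hℓv] at h2
  obtain ⟨he, hf⟩ :=
    ramificationIdx_eq_one_and_inertiaDeg_eq_one_of_ncard_primesOver_eq_two (p := ℓ) hK.1 h2 v hℓv
  exact ZpExtension.decomp_not_le_kerSubgroup_of_isAnticyclotomic_holds K p hK hp2 κ hκ v hpv he hf

/-! ## §2 Exact comparison over `K_∞⁻`: `datumStrictSelmer ∅ = Sel_𝔭(K_∞⁻, E_K[p^∞])` -/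

/-- **`datumStrictSelmer (ker κ) E_K[p^∞] p (bdpData 𝔭) ∅ ≤ Sel_𝔭(K_∞⁻, E_K[p^∞])` on the Heegner leaf**
(the `t = 1` case of `exists_nsmul_mem_selmerAc_of_mem_datumStrictSelmer`): away from `p`, at a place NOT
completely split in `K_∞⁻` unramified ⟹ locally trivial
(`UnramifiedLeAwayKer.unramifiedKer_le_awayKer_of_not_decomp_le`), and a completely split place is GOOD
(§1), where unramified ⟹ locally trivial by Greenberg's Lemma 3.3
(`mem_awayKer_of_mem_unramifiedKer_of_decomp_le`); the infinite places are complex; the strict conditions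
above `p` coincide. Castella 2018 §2.2: "`ℋ^ur_v` vanishes". [cite: Castella2018, §2.2 (arXiv:1704.06608 p. 7)]
[cite: GreenbergLNM1716, §3 Lemma 3.3 (p. 87)] [cite: Brink2007, Thm. 2] -/
theorem datumStrictSelmer_le_selmerAc_of_heegner (hK : IsImaginaryQuadratic K) (hp2 : p ≠ 2)
    {N : ℕ} (hN : W.conductorNorm ℤ = N) (hH : SatisfiesHeegnerHypothesis N K)
    (κ : ZpExtension K p) (hκ : κ.IsAnticyclotomic)
    {𝔭 : HeightOneSpectrum (𝓞 K)} (h𝔭 : ((p : ℕ) : 𝓞 K) ∈ 𝔭.asIdeal) :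
    datumStrictSelmer κ.kerSubgroup ((W.baseChange K).geomPrimaryTorsion p) p
        (AcSelmer.bdpData ((W.baseChange K).geomPrimaryTorsion p) p 𝔭) ∅ ≤
      AcSelmer.selmerAc (W.baseChange K) p κ 𝔭 ∅ := by
  haveI : (W.baseChange K).IsElliptic := by rw [WeierstrassCurve.baseChange]; infer_instance
  intro a ha
  obtain ⟨hunr, hstr⟩ := (mem_datumStrictSelmer_iff a).1 ha
  rw [mem_unramifiedOutside_iff] at hunr
  rw [AcSelmer.selmerAc, AcSelmer.selmerOver_empty_eq_strictSelmerGroupOver p h𝔭,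
    mem_strictSelmerGroupOver_iff]
  refine ⟨fun v hpv σ ↦ ?_, fun w σ ↦ ?_, fun v hv σ ↦ hstr v hv σ⟩
  · have hy := hunr v (Set.notMem_empty v) hpv σ
    by_cases hD : decomp v ≤ κ.kerSubgroup
    · have hgood : (W.baseChange K).HasGoodReductionAt v := by
        by_contra hbad
        exact not_decomp_le_kerSubgroup_of_bad_of_heegner W K p hK hp2 hN hH κ hκ hpv hbad hD
      exact mem_awayKer_of_mem_unramifiedKer_of_decomp_le (W.baseChange K) p hpv hgood hD hy
    · have hI : inertia v ≤ κ.kerSubgroup := by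
        have e : inertia v = (adicCompletionPrime K v).inertia (absoluteGaloisGroup K) :=
          (inertia_adicCompletionPrime_eq_map_absInertia K v).symm
        rw [e]
        exact ZpExtension.inertia_le_kerSubgroup_holds K p κ hpv (adicCompletionPrime_mem_primesAbove K v)
      exact UnramifiedLeAwayKer.unramifiedKer_le_awayKer_of_not_decomp_le κ
        ((W.baseChange K).isOpen_stabilizer_geomPrimaryTorsion' p)
        ((W.baseChange K).exists_pow_smul_geomPrimaryTorsion_eq_zero p) hI hD hy
  · exact mem_infKer_of_decompInf_eq_bot_of_discrete w
      (BigGaloisRep.decompInf_eq_bot_of_isComplex (hK.2.isComplex w)) _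

/-- **`Sel_𝔭(K_∞⁻, E_K[p^∞]) = datumStrictSelmer (ker κ) E_K[p^∞] p (bdpData 𝔭) ∅` on the Heegner leaf**
(membership form): the reverse inclusion is the trivial one (locally trivial ⟹ unramified,
`awayKer_le_unramifiedKer`; the strict conditions above `p` coincide). [cite: Castella2018, Def. 2.2 and §2.2 (arXiv:1704.06608 pp. 5, 7)]
[cite: GreenbergVatsal2000, §2 pp. 15–17] -/
theorem mem_selmerAc_iff_mem_datumStrictSelmer_of_heegner (hK : IsImaginaryQuadratic K) (hp2 : p ≠ 2)
    {N : ℕ} (hN : W.conductorNorm ℤ = N) (hH : SatisfiesHeegnerHypothesis N K)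
    (κ : ZpExtension K p) (hκ : κ.IsAnticyclotomic)
    {𝔭 : HeightOneSpectrum (𝓞 K)} (h𝔭 : ((p : ℕ) : 𝓞 K) ∈ 𝔭.asIdeal)
    (a : (W.baseChange K).subgroupH1 p κ.kerSubgroup) :
    a ∈ AcSelmer.selmerAc (W.baseChange K) p κ 𝔭 ∅ ↔
      a ∈ datumStrictSelmer κ.kerSubgroup ((W.baseChange K).geomPrimaryTorsion p) p
        (AcSelmer.bdpData ((W.baseChange K).geomPrimaryTorsion p) p 𝔭) ∅ := by
  refine ⟨fun ha ↦ ?_, fun ha ↦ datumStrictSelmer_le_selmerAc_of_heegner W K p hK hp2 hN hH κ hκ h𝔭 ha⟩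
  rw [AcSelmer.selmerAc, AcSelmer.selmerOver_empty_eq_strictSelmerGroupOver p h𝔭,
    mem_strictSelmerGroupOver_iff] at ha
  obtain ⟨haway, -, hstr⟩ := ha
  rw [mem_datumStrictSelmer_iff, mem_unramifiedOutside_iff]
  exact ⟨fun v _ hpv σ ↦ awayKer_le_unramifiedKer' v (haway v hpv σ), fun v hv σ ↦ hstr v hv σ⟩

/-! ## §3 Exact descent of local conditions from `K̃_∞` to `K_∞⁻` at a supersingular `p` -/

/-- **Exact descent of the two-variable Greenberg condition to Castella's, Heegner leaf, supersingular `p`.**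
Let `W/ℚ` be elliptic and globally minimal with good SUPERSINGULAR reduction at the odd prime `p` (`p ∣ a_p`),
`K` imaginary quadratic with `p = v v̄` split and the Heegner hypothesis for `N = N_W`, `κ₁` the cyclotomic and
`κ₂` an anticyclotomic `ℤ_p`-extension of `K`. Then for every class `y ∈ H¹(K_∞⁻, E[p^∞])`
(`K_∞⁻ = K̄^{ker κ₂}`): `res y` lies in the two-variable Greenberg group `H¹_{nr,v̄}(K̃_∞, E[p^∞])` IFF
`y ∈ Sel_v̄(K_∞⁻, E[p^∞])` (Castella: strict at `v̄`, relaxed at `v`, trivial away from `p`). Above `v̄`: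
(V) `E[p^∞]^{Gal(K̄/K̃_∞) ⊓ I_v̄} = 0` from Serre's Prop. 12 (c) shape (tree theorems
`isCyclic_and_card_inertia_map_baseChange`, `primary_eq_zero_of_forall_pairKer_inf_inertia_smul_eq`) makes
Greenberg's inertia condition strict (`resOfLe_mem_unrSelmer₂_iff_mem_datumStrictSelmer`); away from `p`:
§2. This is the sibling crux's registered stub `stub_localConditionsDescendSS` (stmt-…-20728, line `ratlift`)
with its idle binders removed. [cite: SkinnerUrban2014, §3.2.7 and Prop. 3.2.8 (p. 23)] [cite: Castella2018, §2.2 (arXiv:1704.06608 p. 7)]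
[cite: Serre1972, §1.11 Prop. 12] [cite: Brink2007, Thm. 2] -/
theorem resOfLe_mem_unrSelmer₂_iff_mem_selmerAc_of_heegner [W.IsGloballyMinimal] (hp2 : p ≠ 2)
    (hgood : W.HasGoodReductionAtPrime p) (hap : (p : ℤ) ∣ W.frobeniusTrace p)
    (hK : IsImaginaryQuadratic K) {N : ℕ} (hN : W.conductorNorm ℤ = N) (hH : SatisfiesHeegnerHypothesis N K)
    {v vbar : HeightOneSpectrum (𝓞 K)} (hv : ((p : ℕ) : 𝓞 K) ∈ v.asIdeal)
    (hvbar : ((p : ℕ) : 𝓞 K) ∈ vbar.asIdeal) (hvv : vbar ≠ v)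
    {κ₁ : ZpExtension K p} (hκ₁ : κ₁.IsCyclotomic) (κ₂ : ZpExtension K p) (hκ₂ : κ₂.IsAnticyclotomic)
    (y : (W.baseChange K).subgroupH1 p κ₂.kerSubgroup) :
    (W.baseChange K).resOfLe p (ZpExtension.pairKer_le_right κ₁ κ₂) y ∈
        unrSelmer₂ κ₁ κ₂ ((W.baseChange K).geomPrimaryTorsion p) vbar ↔
      y ∈ AcSelmer.selmerAc (W.baseChange K) p κ₂ vbar ∅ := by
  haveI : (W.baseChange K).IsElliptic := by rw [WeierstrassCurve.baseChange]; infer_instance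
  -- (V) from Serre's Prop. 12 (c) shape at `v̄`
  obtain ⟨hc, hcard⟩ := InertiaFixedPoint.isCyclic_and_card_inertia_map_baseChange W hp2 hgood hap hK hv hvbar hvv
  have hV : ∀ m : (W.baseChange K).geomPrimaryTorsion p,
      (∀ t ∈ ZpExtension.pairKer κ₁ κ₂ ⊓ inertia vbar, t • m = m) → m = 0 := fun m hm ↦
    InertiaFixedPoint.primary_eq_zero_of_forall_pairKer_inf_inertia_smul_eq (W.baseChange K) κ₁ κ₂ vbar
      hc hcard hm
  rw [resOfLe_mem_unrSelmer₂_iff_mem_datumStrictSelmer hκ₁ κ₂ hvbar hV y,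
    mem_selmerAc_iff_mem_datumStrictSelmer_of_heegner W K p hK hp2 hN hH κ₂ hκ₂ hvbar]

end Summit.BirchSwinnertonDyer.BirchSwinnertonDyer.Theorems.SignedBaseChangeAcDivAwayDiscrepancy

end
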